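import Mathlib
import HarnessLib
import HarnessLib.Audit
import Summits.AtomisticToContinuum.Statement

/-!
Route: LoschmidtAutonomyRigidity

CLOSED (retired) 2026-08-15T13:44:24Z by operator:999:1257524 — reason: not-a-thesis: assembly does not conclude the sub-problem Statement — note: D-0027 §2.1 audit (human 2026-08-15: routes that do not decide the summit are removed): the assembly concludes `Literature.MathematicalPhysics.KineticTheory.HydrodynamicLimit`, not the sub-problem statement; a NEW conforming route may be opened from the same idea (generated `closes : … → _root_.Hydr. The file is kept as the record of this route; refuted decls are indexed as negative knowledge (`ledger negatives`).

# Route LoschmidtAutonomyRigidity — EOS-agnostic autonomous Euler closure + free second law +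
hydrostatic rung force hard-sphere Euler

It suffices to show X = X_A ∧ X_S ∧ X_H (card loschmidt-forward-autonomy-rigidity, run forward and
repaired). X_A (AUTONOMOUS CLOSURE,
EOS-agnostic): below a packing threshold η₀ the empirical fields of local-Gibbs hard-sphere data
follow, in probability, the classical solution of a
compressible Euler system ∂ₜρ+div(ρu)=0, ∂ₜ(ρu)+div(ρu⊗u)+∇p̃=0, ∂ₜE+div((E+p̃)u)=0 with E =
ρ(|u|²/2+3θ/2) and SOME smooth, locally well-posed
pressure law p̃_σ(ρ,θ) — nothing microscopic is identified. X_S (FREE SECOND LAW): whenever such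
data have a deterministic profile V at time 0
and Q at time t, the total hard-sphere entropy ∫ρ(3/2 log θ − log ρ − f_ex(ρσ³)) of Q is ≥ that of V
(Liouville invariance of the global Gibbs
law + static large deviations; De Roeck–Maes–Netočný run forward). X_H (HYDROSTATIC RUNG):
isobaric-for-hsPressure rest local Gibbs states stay
macroscopically static. Then (IsentropicSelection, PDE calculus, provable now): the second law
applied to data (ρ,u,θ) and (ρ,−u,θ) forces
isentropy, hence p̃ = ρθZ(ρσ³) − cθ, and the rung pins c = 0; so the closure IS hs-Euler and the
packing-guarded conjunct HydroLimitInBand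
(shared target, stmt-3093) follows; with DiluteSelfConsistency (shared, stmt-3091) this is
HydrodynamicLimit.
Lean: `AutonomousClosure ∧ LimitSecondLaw ∧ HydrostaticRung`

## Assembly
Pure logic given RigidityBridge (proved sorry-free as `assembly_of_bridge` and `target_bookkeeping`
in the planner's Sketch.lean, lean check rc 0):
the bridge turns the three cruxes and the statics/PDE supports into HydroLimitInBand;
DiluteSelfConsistency at η := η₀ and the min of the two σ₀
give HydrodynamicLimit (the ImplosionLoophole bookkeeping, hydrodynamicLimit_iff).

Rationale: WHY THIS LINE. Spohn1991 (Part I §3.1, PDF p. 40): the description is complete "provided the local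
equilibrium parameters are governed by an autonomous
evolution equation"; every route on the board instead identifies microscopic currents (virial
theorem (3.15), relative entropy, cumulants,
flux Young measures). This line asks only for AUTONOMY WITH EULER FORM and an unknown constitutive
pressure, and lets thermodynamics select the
closure: RoeckMaesNetocny2006 §2–3 (autonomy ⇒ H-theorem; exact autonomy ⇒ H constant) supplies a
FREE second law for any deterministic limit
from Liouville invariance plus Georgii-type static large deviations (GeorgiiZessin1993,
Georgii1994), and the Coleman–Noll entropy principle
(ColemanNoll1963; perfect-fluid constitutive theory Serrin1959, TruesdellNoll2004) run with EQUALITY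
— the entropy production
∫(p_hs−p̃)θ⁻¹div u is odd in u, Loschmidt's reversal at the PDE level — leaves p̃ = p_hs − cθ.
Scoping found that ALL entropy/reversibility/
covariance inputs are blind to the one-parameter family p_hs − cθ (s − c/ρ is materially conserved
and ∫ρ s changes by the constant c·Vol),
so one static number is genuinely needed: the hydrostatic rung (the virial theorem (3.15), "proved
by Presutti (1975)", in microscopic
clothing) pins c = 0. Imported areas: rational thermodynamics (constitutive rigidity), large
deviations for Gibbs point fields, symmetric-
hyperbolic PDE (Majda1984, Kato1975). Unlike invariant-gibbs-entropy-bookkeeping (flux locality) or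
DissipativeWeakStrong (flux Young measures)
no microscopic current appears in any item; negatives index empty at filing.

RANKED CRUXES. #0 HydroLimitInBand (target) — the packing-guarded conjunct (shared with route
ImplosionLoophole, stmt-3093): ∃ η₀ > 0 such that for all continuous positive profiles ∃ σ₀ ∀ σ ∈
(0,σ₀), for every classical hard-sphere Euler solution on [0,T) with ρσ³ < η₀ on [0,T)×𝕋³ and every
flow family, LLN of the fields at t = 0 ⇒ LLN at every t < T. (why it might fail: it is the conjunct
minus the implosion loophole: a hidden slow field, anomalous transport at Euler scale, or failure of
propagation of local equilibrium for deterministic hard spheres would refute it.) [Spohn1991,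
OllaVaradhanYau1993]
#2 AutonomousClosure (crux) — (card item A with the Euler FORM folded in; EOS-agnostic) ∃ η₀ > 0 ∀ σ
> 0 ∃ a pressure law p̃ : (ρ,θ) ↦ p̃(ρ,θ), C^∞ on {ρ > 0, ρσ³ < η₀, θ > 0}, such that (WP) the Euler
system with pressure p̃ and E = ρ(|u|²/2+3θ/2) has a classical solution on some [0,T), T > 0, from
every smooth positive datum with packing < η₀, and (CONV) for all continuous positive local-Gibbs
profiles (a₀,u₀,θ₀), every classical solution of that system on [0,T) with packing < η₀ and every
flow family with the laws probability measures: LLN of the three fields at t = 0 towards the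
solution ⇒ LLN at every t < T. The classical-solution predicate for a general pressure law is bound
once inside the Prop (`∀ IsSol, (∀ p T ρ u θ, IsSol p T ρ u θ ↔ ⟨the eight clauses of
IsHardSphereEulerSolution with hsPressure σ replaced by p⟩) → …`). [difficulty: open-problem] (why
it might fail: A hidden slow extensive field (ideal-gas h(v), hard-rod type) or surviving dependence
on the velocity SHAPE of the data leaves no closed (ρ,u,θ) system; the energy field needs σ-uniform
velocity-tail control (HighMomentumCutoff); with p̃ := hsPressure it is the guarded conjunct
itself.) [Spohn1991, RoeckMaesNetocny2006, OllaVaradhanYau1993, Serrin1959]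
#3 LimitSecondLaw (crux) — (card (P3), the free second law for deterministic limits) ∃ η₀ > 0 ∀ σ >
0, for continuous positive local-Gibbs profiles (a₀,u₀,θ₀) under the activity guard a₀σ³ < η₀∫a₀,
all continuous positive profiles V = (ρ_V,u_V,θ_V), Q = (ρ_Q,u_Q,θ_Q) with packing < η₀, every flow
family with the laws probability measures and every t ≥ 0: if the fields converge in probability to
V at time 0 and to Q at time t, then ∫ρ_V(3/2 log θ_V − log ρ_V − f_ex(ρ_Vσ³)) ≤ ∫ρ_Q(3/2 log θ_Q −
log ρ_Q − f_ex(ρ_Qσ³)) (f_ex = hsExcessFreeEnergy). Mechanism: H(LG|G_N,β)/(N+1) → I_β(V)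
(Varadhan), G_N invariant under the flow, static LD upper bound G_N(fields ≈ Q) ≤ e^(−N
I_β(Q)+o(N)), entropy inequality P(A) ≤ (H+log 2)/log(1+1/G(A)); I_β = βE − S_hs + const and E(Q) =
E(V) exactly (χ ≡ 1). [difficulty: L] (why it might fail: Needs the static LD principle and
H(LG|G_N)/N → I(V) for the CANONICAL hard-sphere law on 𝕋³ with Maxwellian marks, uniformly at
packing < η₀ (GeorgiiZessin1993/Georgii1994 are grand-canonical, infinite volume); exponential
tightness of the kinetic-energy field is also used.) [RoeckMaesNetocny2006, GeorgiiZessin1993,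
Georgii1994, KipnisLandim1999, Ruelle1969]
#4 HydrostaticRung (crux) — (pins the pressure LEVEL; the virial theorem in microscopic clothing) ∃
η₀ > 0 ∀ σ > 0, for continuous positive activity a₀ with a₀σ³ < η₀∫a₀, smooth positive θ₀, ρ₀ with
ρ₀σ³ < η₀ and hsPressure σ ρ₀ θ₀ ≡ const on 𝕋³, and every flow family with the rest local Gibbs laws
localGibbsLaw σ a₀ 0 θ₀ probability measures: if the fields at time 0 converge in probability to
(ρ₀, 0, ρ₀·3θ₀/2) then they converge to the same static profile at every t ≥ 0. [difficulty: L] (why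
it might fail: Uniform in σ under an activity guard (a bit stronger than the conjunct's hydrostatic
case); fails via an O(1) anomalous heat/momentum current in an isobaric rest state over N^(1/3)
collision times, or if the local-Gibbs contact pressure ≠ ρθZ(ρσ³) (virial theorem, Presutti 1975).)
[Spohn1991, LebowitzPenrose1964, Ruelle1969]
#9 IsentropicSelection (support) — (card R(iv) repaired: Coleman–Noll with equality + hydrostatic
pin; pure PDE/calculus, provable now) for η₀, σ > 0 with σ³ < η₀, hsExcessFreeEnergy C^∞ on (0,η₀)
and r ↦ r·Z(rσ³) strictly increasing (positive derivative) for rσ³ < η₀: if a C^∞ pressure law p̃ on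
{ρ>0, ρσ³<η₀, θ>0} is (WP) locally solvable from smooth positive normalised (∫ρ = 1) dilute data,
(ENT) every classical Euler[p̃] solution from such data with packing < η₀ on [0,T) has
non-decreasing total hs-entropy, and (HYD) every such solution from REST data isobaric for
hsPressure σ is constant in time, then p̃ = hsPressure σ on the whole dilute state space (the total
hs-entropy functional S is let-bound once inside the Prop). Proof: d/dt S at 0⁺ = ∫(p_hs−p̃)θ⁻¹ div
u ≥ 0 for all data, odd in u ⇒ = 0 ⇒ (p_hs−p̃)/θ ≡ c (weakly harmonic ⇒ constant; attainability of
any two state points in one normalised profile since σ³ < η₀); HYD at a non-isothermal isobaric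
profile (implicit function from monotonicity) gives c∇θ = 0 ⇒ c = 0. [difficulty: provable-now]
[ColemanNoll1963, Serrin1959, TruesdellNoll2004, Majda1984]
#9 LocalGibbsRealisability (support) — (statics: inverse of the local-Gibbs LLN map) ∃ η₀ > 0 ∀ σ >
0, every continuous positive normalised (∫ρ_V = 1) profile V = (ρ_V,u_V,θ_V) with ρ_Vσ³ < η₀ is the
t = 0 LLN limit of the local Gibbs laws localGibbsLaw σ a₀ u_V θ_V for some continuous positive
activity a₀ with a₀ ≤ 2ρ_V∫a₀ (so packing guards become activity guards), these laws being
probability measures for every N and flow. Low-density cluster expansion: ρ[a] = a e^(−μ_ex)/C, a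
contraction for the inverse; strengthens the proved Literature fact localGibbs_lln by identifying
and inverting the limit density. [difficulty: M] [Ruelle1969, LebowitzPenrose1964, Spohn1991]
#9 HsEosLowDensity (support) — (shared, stmt-0768) analyticity of the hard-sphere excess free energy
at low density with F(0) = 0, F′(0) = 2π/3 and existence of the canonical thermodynamic limit; gives
smoothness of hsPressure and ∂_ρ(ρZ(ρσ³)) > 0 at small packing, the EOS hypotheses of
IsentropicSelection. [difficulty: L] [Ruelle1969, LebowitzPenrose1964]
#9 DiluteSelfConsistency (support) — (shared, stmt-3091 of route ImplosionLoophole) for every η > 0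
and all continuous positive profiles ∃ σ₀ such that for σ < σ₀ every admissible classical
hard-sphere Euler solution keeps packing ρσ³ < η on [0,T); the common hidden PDE input turning
HydroLimitInBand into the conjunct. [difficulty: open-problem] [Spohn1991, Majda1984, Kato1975]
#9 RigidityBridge (support) — (the route's glue, provable now modulo its antecedents)
AutonomousClosure → LimitSecondLaw → HydrostaticRung → IsentropicSelection → LocalGibbsRealisability
→ HsEosLowDensity → HydroLimitInBand. Proof: η₀ := min(η_A, η_S/2, η_H/2, η_R, η_M) with η_M from
HsEosLowDensity (1+2ηF′+η²F″ > 0); given profiles take σ₀ := min(η₀^(1/3), σ₀′) with σ₀′ from the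
proved localGibbs_lln (probability measures); for σ < σ₀ instantiate IsSol, verify (WP) from
AutonomousClosure, (ENT) from LocalGibbsRealisability + AutonomousClosure + LimitSecondLaw (activity
guard a₀σ³ ≤ 2ρσ³∫a₀ < η_S∫a₀), (HYD) from LocalGibbsRealisability + HydrostaticRung +
AutonomousClosure + uniqueness of limits in probability; IsentropicSelection gives p̃_σ = hsPressure
σ on the dilute state space, so a guarded classical hs-Euler solution is an Euler[p̃_σ] solution
(funext on the pressure composite) and (CONV) yields the LLN at every t < T. [difficulty: M]
[Spohn1991, Kato1975]

TWO-LAYER PLAN. AutonomousClosure ⇐ PureAutonomy (deterministic continuous limit paths +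
universality/restart for local Gibbs data, typable with TendstoHydroFieldsAt
alone) → LightConeLocality (law-level finite propagation speed) → AutonomousClosure, the glue being
the card's FORM RIGIDITY R(i)–(iii): locality +
translation/integer-dilation covariance + C¹ generator ⇒ first-order quasilinear, conservation for
all data ⇒ conservation form (closed 1-forms),
cubic + Galilean covariance + exact continuity equation ⇒ Euler form with p̃(ρ,u-free,θ) and zero
heat flux (needs a macro-flow vocabulary,
definition request deferred until a grounder asks). LimitSecondLaw ⇐ CanonicalHsStaticLDP
(Georgii-type, packing < η₀) → LocalGibbsRelEntropyRate
(H(LG|G_N)/N → I_β(V)) → LimitSecondLaw (glue: Liouville invariance + entropy inequality, DMN).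
HydrostaticRung ⇐ ContactPressureIdentity (virial
theorem (3.15), Presutti 1975, at packing < η₀) → RestStateCurrentBound (σ-uniform o(1)
heat/momentum current over [0,t]) → HydrostaticRung. k ≤ 3 each, depth 1.

KILL CRITERIA. AutonomousClosure refuted (a local-Gibbs family whose macroscopic future depends on
more than (ρ,u,θ), e.g. a surviving dependence on the
velocity-shape of the data, or non-convergence of the energy field at fixed packing) closes the
route `refuted:AutonomousClosure` and is strong
evidence against the conjunct itself. HydrostaticRung refuted = the conjunct fails in its
hydrostatic sector: close and file ¬HydroLimitInBand.
LimitSecondLaw can only die with Georgii-type statics for canonical hard spheres — then pivot to the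
grand-canonical / periodic-box LDP form with an
explicit ensemble-equivalence support item. IsentropicSelection refuted (a second degeneracy beyond
p_hs − cθ) forces a pivot: add the missing
static pin as a fourth crux. DenseExcursion (ImplosionLoophole) proved ⇒ DiluteSelfConsistency
refuted ⇒ drop it and re-target the route to
HydroLimitInBand only (RigidityBridge is untouched). HydroLimitInBand proved elsewhere moots the
route.

NOT DECOMPOSED YET. The macro-flow vocabulary and the form-rigidity theorem (layer-2 children of
AutonomousClosure, see Two-layer plan); the uniform-integrability
module for the energy field (shared a-priori input of every route, apriori-tails-and-rattlers);
uniqueness of limits in probability, the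
restriction lemma IsSol p T → IsSol p T′ (T′ ≤ T) and the EOS monotonicity at small packing (lemmas
inside RigidityBridge / IsentropicSelection,
attached with --supports); constants η₀, σ₀ are existential throughout and never computed.

CHEAPEST FALSIFIER. (i) ALGEBRA (minutes, refuter): redo the selection step allowing p̃ to depend on
(ρ,θ) arbitrarily and on the cubic frame: is p_hs − cθ the ONLY
family conserving ∫ρ s_hs along all smooth Euler[p̃] flows on 𝕋³? (the planner's computation: ρθ
Ds/Dt = (p_hs − p̃) div u, so yes up to the
constant c, which HYD kills) — a second degeneracy kills IsentropicSelection as stated. (ii) LOOKUP: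
a printed hidden conserved field / non-Gibbs
regular stationary state for 3-D hard spheres at positive density would kill AutonomousClosure (none
known; ideal gas and hard rods are the
catalogued kernels and are excluded by genuine collisions). (iii) MD (kit, hours): isobaric
non-isothermal rest local-Gibbs data at φ = 0.05–0.1,
N = 10⁵–10⁶: any N-independent O(1) drift of the density profile over t = O(1) kills
HydrostaticRung. Not run here (planner seat, no kit in plancard).

NUMBERS. Z(η) = 1 + (2π/3)η + O(η²) (second virial coefficient of unit-diameter spheres,
HsEosLowDensity); hard-sphere freezing at packing fraction
≈ 0.494 (ρσ³ ≈ 0.943) bounds any admissible η₀ far above the cluster radius actually used; c_v =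
3/2, E = ρ(|u|²/2 + 3θ/2), s_hs = 3/2 log θ −
log ρ − f_ex(ρσ³), p_hs = ρθZ(ρσ³) = −ρ²θ ∂_ρ s_hs·… (Gibbs relation ρ²∂_ρ s = −ρZ, ∂_θ s = 3/(2θ));
entropy production of Euler[p̃] against
s_hs: ρθ Ds/Dt = (p_hs − p̃) div u. Items at open: 10 (1 target, 3 cruxes, 5 support, 1 assembly).

DEFINITION REQUESTS. None filed at open. Deferred (for the foreseen split of AutonomousClosure): a
macro-flow vocabulary `IsAutonomousHydroLimit σ S` / `MacroFlowAxioms`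
under Summits/AtomisticToContinuum/HydrodynamicLimit/Theorems, and a general-EOS classical Euler
predicate `IsEulerSolutionEOS p T ρ u θ` in
Literature/MathematicalPhysics/KineticTheory (here inlined once per Prop through a bound predicate
`IsSol` with its defining ↔, so no item waits on it).

Novelty: Searches (2026-08-15): `lit search --hybrid "autonomous macroscopic evolution H-theorem reversible …
equation of state"` (12 book hits: KipnisLandim1999,
CIP1994, Saint-Raymond 2009, De Masi–Presutti 1991, Gallavotti 2014 … — none derives the EOS from
autonomy); `lit vsearch` on the entropy-principle
selection of pressure (10 textbook hits, generic); `lit search --source s2 "autonomous macroscopic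
dynamics H-theorem reversible microscopic large
deviations"` (5: Lebowitz 1996 survey, Olla 2019, Givon–Kupferman–Stuart 2003); `lit search --source
crossref "Coleman Noll thermodynamics …"`
(8: ColemanNoll1963 located and added to bib, Serrin1959 added); openalex/arxiv/zbmath rate-limited
(429/0 rows), `lit galaxy search … --star all`
queued out (rc 1) — recorded in NOTES.md; Spohn1991 re-read at PDF pp. 40, 43, 53 (autonomy quote;
virial theorem (3.15); "proved by Presutti (1975)").
Plus the card's audit searches (DMN read pp. 3–6; 51 cards grep'd).
Nearest prior art found: RoeckMaesNetocny2006 (doi:10.1007/s10955-006-9079-x: autonomy ⇒ H-theorem,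
exact autonomy ⇒ H constant, read as a no-go);
ColemanNoll1963 + Serrin1959 (entropy principle / perfect-fluid constitutive rigidity with the free
energy as primitive); Spohn1991 §3.1 (Euler
fluxes from the virial theorem); on the board: invariant-gibbs-entropy-bookkeeping (inequality +
flux locality), existence-then-rigidity (retired into this card).
Delta: the conjunct is reduced to an EOS-AGNOSTIC autonomy statement plus two free/chea  [refs: 10.1007/s10955-006-9079-x:, doi:10.1007/s10955-006-9079-x, KipnisLandim1999, CIP1994, ColemanNoll1963, Serrin1959, Spohn1991, RoeckMaesNetocny2006]

Barriers (technique_class: reversibility-rigidity, autonomy, entropy-selection): - technique_class: reversibility-rigidity, autonomy, entropy-selection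
- Literature.Barriers.AtomisticToContinuum.VelocityReversalBarrier: not met at the microscopic level
any more — no every-phase-point derivation, no reversal-closed hypothesis class; reversal is used
only on the macroscopic PDE (data (ρ,u,θ) ↦ (ρ,−u,θ), Euler[p̃] is reversible for every p̃) and
convergence is in probability at both ends for LAWS; VelocityReversalBarrierNarrow's one-sided
classes are exactly what AutonomousClosure quantifies over.
- Literature.Barriers.AtomisticToContinuum.BoltzmannHypothesisBarrier: no stationary-state
classification and no entropy METHOD is used; its kernels (ideal gas: future depends on h(v); hard
rods: extra fields) violate AutonomousClosure, which therefore genuinely consumes collisions —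
conceded that the hidden-slow-variable obstruction re-enters inside AutonomousClosure's proof
(why-might-fail).
- Literature.Barriers.AtomisticToContinuum.MacroErgodicityBarrier: not met (no ergodic or mixing
input; the second law comes from statics + Liouville).
- Literature.Barriers.AtomisticToContinuum.HighMomentumCutoffBarrier: APPLIES to the energy field in
AutonomousClosure (σ-uniform velocity-tail control along the dynamics); not evaded, declared in its
why-might-fail; LimitSecondLaw needs only exponential tightness of the kinetic energy under local
Gibbs laws (static, Gaussian).
- Literature.Barriers.AtomisticToContinuum.ShockFormationBarrier: built in — every item is pre-shock

History (route lifecycle, newest last):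
- 2026-08-15T13:44:24Z · CLOSED retired — not-a-thesis: assembly does not conclude the sub-problem Statement (operator:999:1257524)

sub-problem: HydrodynamicLimit · status: closed(retired) · opened planner-plancard-AtomisticToContinuum-Hydrody-4509dc37-0 2026-08-15T11:43:31Z · rev 0 · ledger route-AtomisticToContinuum-LoschmidtAutonomyRigidity
GENERATED by the gate from the ledger (D-0016/17). Provers cite these decls: `theorem foo : Summit.AtomisticToContinuum.HydrodynamicLimit.Theses.LoschmidtAutonomyRigidity.<Decl> := …` in Summits/AtomisticToContinuum/HydrodynamicLimit/Theorems/<Name>.lean.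
-/

namespace Summit.AtomisticToContinuum.HydrodynamicLimit.Theses.LoschmidtAutonomyRigidity

open scoped BigOperators Topology Manifold Classical MeasureTheory ProbabilityTheory Matrix InnerProductSpace ComplexConjugate ContinuousMap
open Filter Set Function TopologicalSpace MeasureTheory

attribute [summit_statement] _root_.HydrodynamicLimit

/-- item stmt-AtomisticToContinuum-3093 · target · rank 0 · closed · moot by None · by planner
why it might fail: it is the conjunct minus the implosion loophole: a hidden slow field, anomalous transport at Euler scale, or failure of propagation of local equilibrium for deterministic hard spheres would refute it.
sources: Spohn1991, OllaVaradhanYau1993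
[support] [support, NOT staffed by this route] the packing-guarded conjunct: ∃ η₀ > 0 such that for
all continuous positive profiles ∃ σ₀ ∀ σ ∈ (0,σ₀) ∀ classical hard-sphere-Euler solutions on [0,T)
WITH ρ_t(x)σ³ < η₀ on [0,T) × 𝕋³ and all flow families, LLN of the fields at t = 0 ⇒ LLN at every t
< T. This is what the five positive routes deliver in substance (their inputs
LocalGibbsConcentration 0767 / HsEosLowDensity 0768 live at local packing < η₀); the audit's D5
variant HydrodynamicLimitInBand (∀ σ < 1/2 form) implies it. Filed typed so tenure planners can
re-target RelEntropyVanishing / L2HydroFields to guarded versions. [difficulty: open-problem] -/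
@[route_item "route-AtomisticToContinuum-LoschmidtAutonomyRigidity"]
def HydroLimitInBand : Prop :=
  ∃ η₀ : ℝ, 0 < η₀ ∧ ∀ (a₀ θ₀ : Literature.MathematicalPhysics.KineticTheory.T3 → ℝ) (u₀ : Literature.MathematicalPhysics.KineticTheory.T3 → Literature.MathematicalPhysics.KineticTheory.V3), Continuous a₀ → Continuous θ₀ → Continuous u₀ → (∀ x, 0 < a₀ x) → (∀ x, 0 < θ₀ x) → ∃ σ₀ : ℝ, 0 < σ₀ ∧ ∀ σ : ℝ, 0 < σ → σ < σ₀ → ∀ (T : ℝ) (ρ θ : ℝ → Literature.MathematicalPhysics.KineticTheory.T3 → ℝ) (u : ℝ → Literature.MathematicalPhysics.KineticTheory.T3 → Literature.MathematicalPhysics.KineticTheory.V3), Literature.MathematicalPhysics.KineticTheory.IsHardSphereEulerSolution σ T ρ u θ → (∀ t ∈ Set.Ico 0 T, ∀ x, ρ t x * σ ^ 3 < η₀) → ∀ Φ : (N : ℕ) → Literature.Analysis.FluidPDE.HardSphereFlow (Literature.Analysis.FluidPDE.Torus.geometry (Fin 3)) (Literature.MathematicalPhysics.KineticTheory.hsDiameter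 σ N) (N + 1), Literature.MathematicalPhysics.KineticTheory.TendstoHydroFieldsAt (fun N => Literature.MathematicalPhysics.KineticTheory.localGibbsLaw σ a₀ u₀ θ₀ N (Φ N)) Φ ρ u θ 0 → ∀ t ∈ Set.Ico 0 T, Literature.MathematicalPhysics.KineticTheory.TendstoHydroFieldsAt (fun N => Literature.MathematicalPhysics.KineticTheory.localGibbsLaw σ a₀ u₀ θ₀ N (Φ N)) Φ ρ u θ t

/-- item stmt-AtomisticToContinuum-5927 · crux · rank 2 · closed · moot by None · by planner
why it might fail: A hidden slow extensive field (ideal-gas h(v), hard-rod type) or surviving dependence on the velocity SHAPE of the data leaves no closed (ρ,u,θ) system; the energy field needs σ-uniform velocity-tail control (HighMomentumCutoff); with p̃ := hsPressure it is the guarded conjunct itself.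
sources: Spohn1991, RoeckMaesNetocny2006, OllaVaradhanYau1993, Serrin1959
[crux] (card item A with the Euler FORM folded in; EOS-agnostic) ∃ η₀ > 0 ∀ σ > 0 ∃ a pressure law
p̃ : (ρ,θ) ↦ p̃(ρ,θ), C^∞ on {ρ > 0, ρσ³ < η₀, θ > 0}, such that (WP) the Euler system with pressure
p̃ and E = ρ(|u|²/2+3θ/2) has a classical solution on some [0,T), T > 0, from every smooth positive
datum with packing < η₀, and (CONV) for all continuous positive local-Gibbs profiles (a₀,u₀,θ₀),
every classical solution of that system on [0,T) with packing < η₀ and every flow family with the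
laws probability measures: LLN of the three fields at t = 0 towards the solution ⇒ LLN at every t <
T. The classical-solution predicate for a general pressure law is bound once inside the Prop (`∀
IsSol, (∀ p T ρ u θ, IsSol p T ρ u θ ↔ ⟨the eight clauses of IsHardSphereEulerSolution with
hsPressure σ replaced by p⟩) → …`). [difficulty: open-problem] -/
@[route_item "route-AtomisticToContinuum-LoschmidtAutonomyRigidity"]
def AutonomousClosure : Prop :=
  ∀ IsSol : (ℝ → ℝ → ℝ) → ℝ → (ℝ → Literature.MathematicalPhysics.KineticTheory.T3 → ℝ) → (ℝ → Literature.MathematicalPhysics.KineticTheory.T3 → Literature.MathematicalPhysics.KineticTheory.V3) → (ℝ → Literature.MathematicalPhysics.KineticTheory.T3 → ℝ) → Prop, (∀ p T ρ u θ, IsSol p T ρ u θ ↔ (Literature.Analysis.FunctionSpaces.Torus.IsSmoothSpaceTimeOn (Set.Ico 0 T) ρ ∧ Literature.Analysis.FunctionSpaces.Torus.IsSmoothSpaceTimeOn (Set.Ico 0 T) u ∧ Literature.Analysis.FunctionSpaces.Torus.IsSmoothSpaceTimeOn (Set.Ico 0 T) θ ∧ (∀ t ∈ Set.Ico 0 T,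 ∀ x, 0 < ρ t x) ∧ (∀ t ∈ Set.Ico 0 T, ∀ x, 0 < θ t x) ∧ (∀ t ∈ Set.Ico 0 T, ∀ x, Literature.Analysis.FunctionSpaces.Torus.timeDerivWithin (Set.Ico 0 T) ρ t x + Literature.Analysis.FunctionSpaces.Torus.divergence (fun y => ρ t y • u t y) x = 0) ∧ (∀ t ∈ Set.Ico 0 T, ∀ x, Literature.Analysis.FunctionSpaces.Torus.timeDerivWithin (Set.Ico 0 T) (fun s y => ρ s y • u s y) t x + (∑ i, Literature.Analysis.FunctionSpaces.Torus.partialDeriv i (fun y => (ρ t y * u t y i) • u t y) x) + Literature.Analysis.FunctionSpaces.Torus.gradient (fun y => p (ρ t y) (θ t y)) x = 0) ∧ (∀ t ∈ Set.Ico 0 T, ∀ x, Literature.Analysis.FunctionSpaces.Torus.timeDerivWithin (Set.Ico 0 T) (fun s y => Literature.MathematicalPhysics.KineticTheory.totalEnergyDensity (ρ s y) (u s y) (θ s y)) t x + Literature.Analysis.FunctionSpaces.Torus.divergence (fun y => (Literature.MathematicalPhysics.KineticTheory.totalEnergyDensity (ρ t y) (u t y) (θ t y) + p (ρ t y) (θ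 t y)) • u t y) x = 0))) → ∃ η₀ : ℝ, 0 < η₀ ∧ ∀ σ : ℝ, 0 < σ → ∃ p : ℝ → ℝ → ℝ, ContDiffOn ℝ (⊤ : ℕ∞) (fun q : ℝ × ℝ => p q.1 q.2) {q : ℝ × ℝ | 0 < q.1 ∧ q.1 * σ ^ 3 < η₀ ∧ 0 < q.2} ∧ (∀ (ρ₀ θ₀ : Literature.MathematicalPhysics.KineticTheory.T3 → ℝ) (u₀ : Literature.MathematicalPhysics.KineticTheory.T3 → Literature.MathematicalPhysics.KineticTheory.V3), Literature.Analysis.FunctionSpaces.Torus.IsSmooth ρ₀ → Literature.Analysis.FunctionSpaces.Torus.IsSmooth θ₀ → Literature.Analysis.FunctionSpaces.Torus.IsSmooth u₀ → (∀ x, 0 < ρ₀ x) → (∀ x, 0 < θ₀ x) → (∀ x, ρ₀ x * σ ^ 3 < η₀) → ∃ T : ℝ, 0 < T ∧ ∃ (ρ θ : ℝ → Literature.MathematicalPhysics.KineticTheory.T3 → ℝ) (u : ℝ → Literature.MathematicalPhysics.KineticTheory.T3 → Literature.MathematicalPhysics.KineticTheory.V3), IsSol p T ρ u θ ∧ ρ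 0 = ρ₀ ∧ u 0 = u₀ ∧ θ 0 = θ₀) ∧ ∀ (a₀ θ₀ : Literature.MathematicalPhysics.KineticTheory.T3 → ℝ) (u₀ : Literature.MathematicalPhysics.KineticTheory.T3 → Literature.MathematicalPhysics.KineticTheory.V3), Continuous a₀ → Continuous θ₀ → Continuous u₀ → (∀ x, 0 < a₀ x) → (∀ x, 0 < θ₀ x) → ∀ (T : ℝ) (ρ θ : ℝ → Literature.MathematicalPhysics.KineticTheory.T3 → ℝ) (u : ℝ → Literature.MathematicalPhysics.KineticTheory.T3 → Literature.MathematicalPhysics.KineticTheory.V3), IsSol p T ρ u θ → (∀ t ∈ Set.Ico 0 T, ∀ x, ρ t x * σ ^ 3 < η₀) → ∀ Φ : (N : ℕ) → Literature.Analysis.FluidPDE.HardSphereFlow (Literature.Analysis.FluidPDE.Torus.geometry (Fin 3)) (Literature.MathematicalPhysics.KineticTheory.hsDiameter σ N) (N + 1), (∀ N, MeasureTheory.IsProbabilityMeasure (Literature.MathematicalPhysics.KineticTheory.localGibbsLaw σ a₀ u₀ θ₀ N (Φ N))) → Literature.MathematicalPhysics.KineticTheory.TendstoHydroFieldsAt (fun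 N => Literature.MathematicalPhysics.KineticTheory.localGibbsLaw σ a₀ u₀ θ₀ N (Φ N)) Φ ρ u θ 0 → ∀ t ∈ Set.Ico 0 T, Literature.MathematicalPhysics.KineticTheory.TendstoHydroFieldsAt (fun N => Literature.MathematicalPhysics.KineticTheory.localGibbsLaw σ a₀ u₀ θ₀ N (Φ N)) Φ ρ u θ t

/-- item stmt-AtomisticToContinuum-5928 · crux · rank 3 · closed · moot by None · by planner
why it might fail: Needs the static LD principle and H(LG|G_N)/N → I(V) for the CANONICAL hard-sphere law on 𝕋³ with Maxwellian marks, uniformly at packing < η₀ (GeorgiiZessin1993/Georgii1994 are grand-canonical, infinite volume); exponential tightness of the kinetic-energy field is also used.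
sources: RoeckMaesNetocny2006, GeorgiiZessin1993, Georgii1994, KipnisLandim1999, Ruelle1969
[crux] (card (P3), the free second law for deterministic limits) ∃ η₀ > 0 ∀ σ > 0, for continuous
positive local-Gibbs profiles (a₀,u₀,θ₀) under the activity guard a₀σ³ < η₀∫a₀, all continuous
positive profiles V = (ρ_V,u_V,θ_V), Q = (ρ_Q,u_Q,θ_Q) with packing < η₀, every flow family with the
laws probability measures and every t ≥ 0: if the fields converge in probability to V at time 0 and
to Q at time t, then ∫ρ_V(3/2 log θ_V − log ρ_V − f_ex(ρ_Vσ³)) ≤ ∫ρ_Q(3/2 log θ_Q − log ρ_Q −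
f_ex(ρ_Qσ³)) (f_ex = hsExcessFreeEnergy). Mechanism: H(LG|G_N,β)/(N+1) → I_β(V) (Varadhan), G_N
invariant under the flow, static LD upper bound G_N(fields ≈ Q) ≤ e^(−N I_β(Q)+o(N)), entropy
inequality P(A) ≤ (H+log 2)/log(1+1/G(A)); I_β = βE − S_hs + const and E(Q) = E(V) exactly (χ ≡ 1).
[difficulty: L] -/
@[route_item "route-AtomisticToContinuum-LoschmidtAutonomyRigidity"]
def LimitSecondLaw : Prop :=
  ∃ η₀ : ℝ, 0 < η₀ ∧ ∀ σ : ℝ, 0 < σ → ∀ (a₀ θ₀ : Literature.MathematicalPhysics.KineticTheory.T3 → ℝ) (u₀ : Literature.MathematicalPhysics.KineticTheory.T3 → Literature.MathematicalPhysics.KineticTheory.V3), Continuous a₀ → Continuous θ₀ → Continuous u₀ → (∀ x, 0 < a₀ x) → (∀ x, 0 < θ₀ x) → (∀ x, a₀ x * σ ^ 3 < η₀ * ∫ y, a₀ y) → ∀ (ρV θV : Literature.MathematicalPhysics.KineticTheory.T3 → ℝ) (uV : Literature.MathematicalPhysics.KineticTheory.T3 → Literature.MathematicalPhysics.KineticTheory.V3)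 (ρQ θQ : Literature.MathematicalPhysics.KineticTheory.T3 → ℝ) (uQ : Literature.MathematicalPhysics.KineticTheory.T3 → Literature.MathematicalPhysics.KineticTheory.V3), Continuous ρV → Continuous θV → Continuous uV → Continuous ρQ → Continuous θQ → Continuous uQ → (∀ x, 0 < ρV x) → (∀ x, 0 < θV x) → (∀ x, 0 < ρQ x) → (∀ x, 0 < θQ x) → (∀ x, ρV x * σ ^ 3 < η₀) → (∀ x, ρQ x * σ ^ 3 < η₀) → ∀ Φ : (N : ℕ) → Literature.Analysis.FluidPDE.HardSphereFlow (Literature.Analysis.FluidPDE.Torus.geometry (Fin 3)) (Literature.MathematicalPhysics.KineticTheory.hsDiameter σ N) (N + 1), (∀ N, MeasureTheory.IsProbabilityMeasure (Literature.MathematicalPhysics.KineticTheory.localGibbsLaw σ a₀ u₀ θ₀ N (Φ N))) → ∀ t : ℝ, 0 ≤ t → Literature.MathematicalPhysics.KineticTheory.TendstoHydroFieldsAt (fun N => Literature.MathematicalPhysics.KineticTheory.localGibbsLaw σ a₀ u₀ θ₀ N (Φ N)) Φ (fun _ => ρV) (fun _ => uV) (fun _ => θV) 0 → Literature.MathematicalPhysics.KineticTheory.TendstoHydroFieldsAt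 (fun N => Literature.MathematicalPhysics.KineticTheory.localGibbsLaw σ a₀ u₀ θ₀ N (Φ N)) Φ (fun _ => ρQ) (fun _ => uQ) (fun _ => θQ) t → ∫ x, ρV x * (3 / 2 * Real.log (θV x) - Real.log (ρV x) - Literature.MathematicalPhysics.KineticTheory.hsExcessFreeEnergy (ρV x * σ ^ 3)) ≤ ∫ x, ρQ x * (3 / 2 * Real.log (θQ x) - Real.log (ρQ x) - Literature.MathematicalPhysics.KineticTheory.hsExcessFreeEnergy (ρQ x * σ ^ 3))

/-- item stmt-AtomisticToContinuum-5929 · crux · rank 4 · closed · moot by None · by planner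
why it might fail: Uniform in σ under an activity guard (a bit stronger than the conjunct's hydrostatic case); fails via an O(1) anomalous heat/momentum current in an isobaric rest state over N^(1/3) collision times, or if the local-Gibbs contact pressure ≠ ρθZ(ρσ³) (virial theorem, Presutti 1975).
sources: Spohn1991, LebowitzPenrose1964, Ruelle1969
[crux] (pins the pressure LEVEL; the virial theorem in microscopic clothing) ∃ η₀ > 0 ∀ σ > 0, for
continuous positive activity a₀ with a₀σ³ < η₀∫a₀, smooth positive θ₀, ρ₀ with ρ₀σ³ < η₀ and
hsPressure σ ρ₀ θ₀ ≡ const on 𝕋³, and every flow family with the rest local Gibbs laws localGibbsLaw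
σ a₀ 0 θ₀ probability measures: if the fields at time 0 converge in probability to (ρ₀, 0, ρ₀·3θ₀/2)
then they converge to the same static profile at every t ≥ 0. [difficulty: L] -/
@[route_item "route-AtomisticToContinuum-LoschmidtAutonomyRigidity"]
def HydrostaticRung : Prop :=
  ∃ η₀ : ℝ, 0 < η₀ ∧ ∀ σ : ℝ, 0 < σ → ∀ (a₀ θ₀ ρ₀ : Literature.MathematicalPhysics.KineticTheory.T3 → ℝ), Continuous a₀ → Literature.Analysis.FunctionSpaces.Torus.IsSmooth θ₀ → Literature.Analysis.FunctionSpaces.Torus.IsSmooth ρ₀ → (∀ x, 0 < a₀ x) → (∀ x, 0 < θ₀ x) → (∀ x, 0 < ρ₀ x) → (∀ x, a₀ x * σ ^ 3 < η₀ * ∫ y, a₀ y) → (∀ x, ρ₀ x * σ ^ 3 < η₀) → (∀ x y, Literature.MathematicalPhysics.KineticTheory.hsPressure σ (ρ₀ x) (θ₀ x) = Literature.MathematicalPhysics.KineticTheory.hsPressure σ (ρ₀ y) (θ₀ y)) → ∀ Φ : (N : ℕ) → Literature.Analysis.FluidPDE.HardSphereFlow (Literature.Analysis.FluidPDE.Torus.geometry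 (Fin 3)) (Literature.MathematicalPhysics.KineticTheory.hsDiameter σ N) (N + 1), (∀ N, MeasureTheory.IsProbabilityMeasure (Literature.MathematicalPhysics.KineticTheory.localGibbsLaw σ a₀ (fun _ => 0) θ₀ N (Φ N))) → Literature.MathematicalPhysics.KineticTheory.TendstoHydroFieldsAt (fun N => Literature.MathematicalPhysics.KineticTheory.localGibbsLaw σ a₀ (fun _ => 0) θ₀ N (Φ N)) Φ (fun _ => ρ₀) (fun _ _ => 0) (fun _ => θ₀) 0 → ∀ t : ℝ, 0 ≤ t → Literature.MathematicalPhysics.KineticTheory.TendstoHydroFieldsAt (fun N => Literature.MathematicalPhysics.KineticTheory.localGibbsLaw σ a₀ (fun _ => 0) θ₀ N (Φ N)) Φ (fun _ => ρ₀) (fun _ _ => 0) (fun _ => θ₀) t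

/-- item stmt-AtomisticToContinuum-0768 · support · rank 9 · open · by planner
sources: Ruelle1969, LebowitzPenrose1964
[support] Hard-sphere equation of state at low density: ∃ η₀ > 0 and F real-analytic on (−η₀, η₀)
with hsExcessFreeEnergy = F on [0, η₀), F(0) = 0, F'(0) = 2π/3 (second virial coefficient of
unit-diameter spheres), and the canonical thermodynamic limit −N⁻¹ log hsFreeVolume η N → F(η)
exists (not just limsup) for η ∈ [0, η₀). Ruelle1969 §3.4 (existence), LebowitzPenrose1964
(convergence of the virial expansion ⇒ analyticity). Makes hsCompressibility/hsPressure smooth and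
Z(η) = 1 + (2π/3)η + O(η²); needed by every route (hyperbolicity of the Euler system, virial
theorem). -/
@[route_item "route-AtomisticToContinuum-LoschmidtAutonomyRigidity"]
def HsEosLowDensity : Prop :=
  ∃ η₀ : ℝ, 0 < η₀ ∧ ∃ F : ℝ → ℝ, AnalyticOnNhd ℝ F (Set.Ioo (-η₀) η₀) ∧ Set.EqOn Literature.MathematicalPhysics.KineticTheory.hsExcessFreeEnergy F (Set.Ico 0 η₀) ∧ F 0 = 0 ∧ deriv F 0 = 2 * Real.pi / 3 ∧ ∀ η ∈ Set.Ico 0 η₀, Filter.Tendsto (fun N : ℕ => -(N : ℝ)⁻¹ * Real.log (Literature.MathematicalPhysics.KineticTheory.hsFreeVolume η N)) Filter.atTop (nhds (F η))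

/-- item stmt-AtomisticToContinuum-3091 · support · rank 9 · open · by planner
sources: Spohn1991, Majda1984, Kato1975
[crux] (card crux 1B ∪ 3; the hidden PDE crux of every route) for every η > 0 and all continuous
positive profiles there is σ₀ > 0 such that for 0 < σ < σ₀, every classical hard-sphere-Euler
solution on [0,T) whose t = 0 fields are the LLN limit of the local Gibbs laws satisfies ρ_t(x)σ³ <
η for all t < T and x — i.e. limsup_{σ→0} σ³ sup_{t<T*_σ} ‖ρ_σ(t)‖_∞ = 0 profile by profile. For
profiles whose ideal-gas development is global or breaks by a non-degenerate shock (Luk–Speck /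
Buckmaster–Shkoller–Vicol open sets) this is stability of shock formation under an O(σ³)
equation-of-state and data perturbation; in general it is a σ-uniform density bound at the FIRST
singularity of 3-D compressible Euler for all smooth data. [deps: EosContinuity,
LocalGibbsDensityLimit] [difficulty: open-problem] -/
@[route_item "route-AtomisticToContinuum-LoschmidtAutonomyRigidity"]
def DiluteSelfConsistency : Prop :=
  ∀ η : ℝ, 0 < η → ∀ (a₀ θ₀ : Literature.MathematicalPhysics.KineticTheory.T3 → ℝ) (u₀ : Literature.MathematicalPhysics.KineticTheory.T3 → Literature.MathematicalPhysics.KineticTheory.V3), Continuous a₀ → Continuous θ₀ → Continuous u₀ → (∀ x, 0 < a₀ x) → (∀ x, 0 < θ₀ x) → ∃ σ₀ : ℝ, 0 < σ₀ ∧ ∀ σ : ℝ, 0 < σ → σ < σ₀ → ∀ (T : ℝ) (ρ θ : ℝ → Literature.MathematicalPhysics.KineticTheory.T3 → ℝ) (u : ℝ → Literature.MathematicalPhysics.KineticTheory.T3 → Literature.MathematicalPhysics.KineticTheory.V3), Literature.MathematicalPhysics.KineticTheory.IsHardSphereEulerSolution σ T ρ u θ → ∀ Φ : (N : ℕ) →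 Literature.Analysis.FluidPDE.HardSphereFlow (Literature.Analysis.FluidPDE.Torus.geometry (Fin 3)) (Literature.MathematicalPhysics.KineticTheory.hsDiameter σ N) (N + 1), Literature.MathematicalPhysics.KineticTheory.TendstoHydroFieldsAt (fun N => Literature.MathematicalPhysics.KineticTheory.localGibbsLaw σ a₀ u₀ θ₀ N (Φ N)) Φ ρ u θ 0 → ∀ t ∈ Set.Ico 0 T, ∀ x, ρ t x * σ ^ 3 < η

/-- item stmt-AtomisticToContinuum-5930 · support · rank 9 · closed · moot by None · by planner
sources: ColemanNoll1963, Serrin1959, TruesdellNoll2004, Majda1984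
[support] (card R(iv) repaired: Coleman–Noll with equality + hydrostatic pin; pure PDE/calculus,
provable now) for η₀, σ > 0 with σ³ < η₀, hsExcessFreeEnergy C^∞ on (0,η₀) and r ↦ r·Z(rσ³) strictly
increasing (positive derivative) for rσ³ < η₀: if a C^∞ pressure law p̃ on {ρ>0, ρσ³<η₀, θ>0} is
(WP) locally solvable from smooth positive normalised (∫ρ = 1) dilute data, (ENT) every classical
Euler[p̃] solution from such data with packing < η₀ on [0,T) has non-decreasing total hs-entropy,
and (HYD) every such solution from REST data isobaric for hsPressure σ is constant in time, then p̃
= hsPressure σ on the whole dilute state space (the total hs-entropy functional S is let-bound once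
inside the Prop). Proof: d/dt S at 0⁺ = ∫(p_hs−p̃)θ⁻¹ div u ≥ 0 for all data, odd in u ⇒ = 0 ⇒
(p_hs−p̃)/θ ≡ c (weakly harmonic ⇒ constant; attainability of any two state points in one normalised
profile since σ³ < η₀); HYD at a non-isothermal isobaric profile (implicit function from
monotonicity) gives c∇θ = 0 ⇒ c = 0. [difficulty: provable-now] -/
@[route_item "route-AtomisticToContinuum-LoschmidtAutonomyRigidity"]
def IsentropicSelection : Prop :=
  ∀ IsSol : (ℝ → ℝ → ℝ) → ℝ → (ℝ → Literature.MathematicalPhysics.KineticTheory.T3 → ℝ) → (ℝ → Literature.MathematicalPhysics.KineticTheory.T3 → Literature.MathematicalPhysics.KineticTheory.V3) → (ℝ → Literature.MathematicalPhysics.KineticTheory.T3 → ℝ) → Prop, (∀ p T ρ u θ, IsSol p T ρ u θ ↔ (Literature.Analysis.FunctionSpaces.Torus.IsSmoothSpaceTimeOn (Set.Ico 0 T) ρ ∧ Literature.Analysis.FunctionSpaces.Torus.IsSmoothSpaceTimeOn (Set.Ico 0 T) u ∧ Literature.Analysis.FunctionSpaces.Torus.IsSmoothSpaceTimeOn (Set.Ico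 0 T) θ ∧ (∀ t ∈ Set.Ico 0 T, ∀ x, 0 < ρ t x) ∧ (∀ t ∈ Set.Ico 0 T, ∀ x, 0 < θ t x) ∧ (∀ t ∈ Set.Ico 0 T, ∀ x, Literature.Analysis.FunctionSpaces.Torus.timeDerivWithin (Set.Ico 0 T) ρ t x + Literature.Analysis.FunctionSpaces.Torus.divergence (fun y => ρ t y • u t y) x = 0) ∧ (∀ t ∈ Set.Ico 0 T, ∀ x, Literature.Analysis.FunctionSpaces.Torus.timeDerivWithin (Set.Ico 0 T) (fun s y => ρ s y • u s y) t x + (∑ i, Literature.Analysis.FunctionSpaces.Torus.partialDeriv i (fun y => (ρ t y * u t y i) • u t y) x) + Literature.Analysis.FunctionSpaces.Torus.gradient (fun y => p (ρ t y) (θ t y)) x = 0) ∧ (∀ t ∈ Set.Ico 0 T, ∀ x, Literature.Analysis.FunctionSpaces.Torus.timeDerivWithin (Set.Ico 0 T) (fun s y => Literature.MathematicalPhysics.KineticTheory.totalEnergyDensity (ρ s y) (u s y) (θ s y)) t x + Literature.Analysis.FunctionSpaces.Torus.divergence (fun y => (Literature.MathematicalPhysics.KineticTheory.totalEnergyDensity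 (ρ t y) (u t y) (θ t y) + p (ρ t y) (θ t y)) • u t y) x = 0))) → ∀ η₀ σ : ℝ, let S : (Literature.MathematicalPhysics.KineticTheory.T3 → ℝ) → (Literature.MathematicalPhysics.KineticTheory.T3 → ℝ) → ℝ := fun ρ' θ' => ∫ x, ρ' x * (3 / 2 * Real.log (θ' x) - Real.log (ρ' x) - Literature.MathematicalPhysics.KineticTheory.hsExcessFreeEnergy (ρ' x * σ ^ 3)); 0 < η₀ → 0 < σ → σ ^ 3 < η₀ → ContDiffOn ℝ (⊤ : ℕ∞) Literature.MathematicalPhysics.KineticTheory.hsExcessFreeEnergy (Set.Ioo 0 η₀) → (∀ r : ℝ, 0 < r → r * σ ^ 3 < η₀ → 0 < deriv (fun r' : ℝ => r' * Literature.MathematicalPhysics.KineticTheory.hsCompressibility (r' * σ ^ 3)) r) → ∀ p : ℝ → ℝ → ℝ, ContDiffOn ℝ (⊤ : ℕ∞) (fun q : ℝ × ℝ => p q.1 q.2) {q : ℝ × ℝ | 0 < q.1 ∧ q.1 * σ ^ 3 < η₀ ∧ 0 < q.2} → (∀ (ρ₀ θ₀ : Literature.MathematicalPhysics.KineticTheory.T3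 → ℝ) (u₀ : Literature.MathematicalPhysics.KineticTheory.T3 → Literature.MathematicalPhysics.KineticTheory.V3), Literature.Analysis.FunctionSpaces.Torus.IsSmooth ρ₀ → Literature.Analysis.FunctionSpaces.Torus.IsSmooth θ₀ → Literature.Analysis.FunctionSpaces.Torus.IsSmooth u₀ → (∀ x, 0 < ρ₀ x) → (∀ x, 0 < θ₀ x) → (∫ x, ρ₀ x = 1) → (∀ x, ρ₀ x * σ ^ 3 < η₀) → ∃ T : ℝ, 0 < T ∧ ∃ (ρ θ : ℝ → Literature.MathematicalPhysics.KineticTheory.T3 → ℝ) (u : ℝ → Literature.MathematicalPhysics.KineticTheory.T3 → Literature.MathematicalPhysics.KineticTheory.V3), IsSol p T ρ u θ ∧ ρ 0 = ρ₀ ∧ u 0 = u₀ ∧ θ 0 = θ₀) → (∀ (T : ℝ) (ρ θ : ℝ → Literature.MathematicalPhysics.KineticTheory.T3 → ℝ) (u : ℝ → Literature.MathematicalPhysics.KineticTheory.T3 → Literature.MathematicalPhysics.KineticTheory.V3), IsSol p T ρ u θ → (∫ x, ρ 0 x = 1) → (∀ t ∈ Set.Ico 0 T, ∀ x, ρ t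 x * σ ^ 3 < η₀) → ∀ t ∈ Set.Ico 0 T, S (ρ 0) (θ 0) ≤ S (ρ t) (θ t)) → (∀ (T : ℝ) (ρ θ : ℝ → Literature.MathematicalPhysics.KineticTheory.T3 → ℝ) (u : ℝ → Literature.MathematicalPhysics.KineticTheory.T3 → Literature.MathematicalPhysics.KineticTheory.V3), IsSol p T ρ u θ → (u 0 = fun _ => 0) → (∫ x, ρ 0 x = 1) → (∀ t ∈ Set.Ico 0 T, ∀ x, ρ t x * σ ^ 3 < η₀) → (∀ x y, Literature.MathematicalPhysics.KineticTheory.hsPressure σ (ρ 0 x) (θ 0 x) = Literature.MathematicalPhysics.KineticTheory.hsPressure σ (ρ 0 y) (θ 0 y)) → ∀ t ∈ Set.Ico 0 T, ρ t = ρ 0 ∧ u t = u 0 ∧ θ t = θ 0) → ∀ r ϑ : ℝ, 0 < r → r * σ ^ 3 < η₀ → 0 < ϑ → p r ϑ = Literature.MathematicalPhysics.KineticTheory.hsPressure σ r ϑ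

/-- item stmt-AtomisticToContinuum-5931 · support · rank 9 · closed · moot by None · by planner
sources: Ruelle1969, LebowitzPenrose1964, Spohn1991
[support] (statics: inverse of the local-Gibbs LLN map) ∃ η₀ > 0 ∀ σ > 0, every continuous positive
normalised (∫ρ_V = 1) profile V = (ρ_V,u_V,θ_V) with ρ_Vσ³ < η₀ is the t = 0 LLN limit of the local
Gibbs laws localGibbsLaw σ a₀ u_V θ_V for some continuous positive activity a₀ with a₀ ≤ 2ρ_V∫a₀ (so
packing guards become activity guards), these laws being probability measures for every N and flow.
Low-density cluster expansion: ρ[a] = a e^(−μ_ex)/C, a contraction for the inverse; strengthens the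
proved Literature fact localGibbs_lln by identifying and inverting the limit density. [difficulty:
M] -/
@[route_item "route-AtomisticToContinuum-LoschmidtAutonomyRigidity"]
def LocalGibbsRealisability : Prop :=
  ∃ η₀ : ℝ, 0 < η₀ ∧ ∀ σ : ℝ, 0 < σ → ∀ (ρV θV : Literature.MathematicalPhysics.KineticTheory.T3 → ℝ) (uV : Literature.MathematicalPhysics.KineticTheory.T3 → Literature.MathematicalPhysics.KineticTheory.V3), Continuous ρV → Continuous θV → Continuous uV → (∀ x, 0 < ρV x) → (∀ x, 0 < θV x) → (∫ x, ρV x = 1) → (∀ x, ρV x * σ ^ 3 < η₀) → ∃ a₀ : Literature.MathematicalPhysics.KineticTheory.T3 → ℝ, Continuous a₀ ∧ (∀ x, 0 < a₀ x) ∧ (∀ x, a₀ x ≤ 2 * ρV x * ∫ y, a₀ y) ∧ ∀ Φ : (N : ℕ) → Literature.Analysis.FluidPDE.HardSphereFlow (Literature.Analysis.FluidPDE.Torus.geometry (Fin 3)) (Literature.MathematicalPhysics.KineticTheory.hsDiameter σ N) (N + 1), (∀ N, MeasureTheory.IsProbabilityMeasure (Literature.MathematicalPhysics.KineticTheory.localGibbsLaw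 σ a₀ uV θV N (Φ N))) ∧ Literature.MathematicalPhysics.KineticTheory.TendstoHydroFieldsAt (fun N => Literature.MathematicalPhysics.KineticTheory.localGibbsLaw σ a₀ uV θV N (Φ N)) Φ (fun _ => ρV) (fun _ => uV) (fun _ => θV) 0

/-- item stmt-AtomisticToContinuum-5932 · support · rank 9 · closed · moot by None · by planner
sources: Spohn1991, Kato1975
[support] (the route's glue, provable now modulo its antecedents) AutonomousClosure → LimitSecondLaw
→ HydrostaticRung → IsentropicSelection → LocalGibbsRealisability → HsEosLowDensity →
HydroLimitInBand. Proof: η₀ := min(η_A, η_S/2, η_H/2, η_R, η_M) with η_M from HsEosLowDensity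
(1+2ηF′+η²F″ > 0); given profiles take σ₀ := min(η₀^(1/3), σ₀′) with σ₀′ from the proved
localGibbs_lln (probability measures); for σ < σ₀ instantiate IsSol, verify (WP) from
AutonomousClosure, (ENT) from LocalGibbsRealisability + AutonomousClosure + LimitSecondLaw (activity
guard a₀σ³ ≤ 2ρσ³∫a₀ < η_S∫a₀), (HYD) from LocalGibbsRealisability + HydrostaticRung +
AutonomousClosure + uniqueness of limits in probability; IsentropicSelection gives p̃_σ = hsPressure
σ on the dilute state space, so a guarded classical hs-Euler solution is an Euler[p̃_σ] solution
(funext on the pressure composite) and (CONV) yields the LLN at every t < T. [difficulty: M] -/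
@[route_item "route-AtomisticToContinuum-LoschmidtAutonomyRigidity"]
def RigidityBridge : Prop :=
  AutonomousClosure → LimitSecondLaw → HydrostaticRung → IsentropicSelection → LocalGibbsRealisability → HsEosLowDensity → HydroLimitInBand

/-- item stmt-AtomisticToContinuum-5933 · assembly · rank 1 · closed · moot by None · by planner
sources: Spohn1991, OllaVaradhanYau1993
[assembly] AutonomousClosure → LimitSecondLaw → HydrostaticRung → IsentropicSelection →
LocalGibbsRealisability → HsEosLowDensity → DiluteSelfConsistency → HydrodynamicLimit. -/
@[route_item "route-AtomisticToContinuum-LoschmidtAutonomyRigidity"]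
def Assembly : Prop :=
  AutonomousClosure → LimitSecondLaw → HydrostaticRung → IsentropicSelection → LocalGibbsRealisability → HsEosLowDensity → DiluteSelfConsistency → Literature.MathematicalPhysics.KineticTheory.HydrodynamicLimit

end Summit.AtomisticToContinuum.HydrodynamicLimit.Theses.LoschmidtAutonomyRigidity
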